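import Mathlib
import HarnessLib
import Summits.QuantumFields.YangMills.Theorems.MirrorModularBoostsHypercubicLimitCouplingResponseDefsC

/-!
# Stub `stub_volumeFloor` for the crux `WeakCouplingHypercubicLimit` (line `Sketch`, W4)

Pure real analysis: polynomial volume growth `PolyVolume sch` (`a_k⁻¹ ≤ (a_k L_k)^N` eventually) and
`a_k L_k → ∞` give the "volume floor" of the cold-pressure lever,
`C₀ (2S'+1)³ e^{−Δ a_k S'/2} ≤ K` for all `S' ≥ L_k`, eventually in `k`.

Proof.  Eventually `1 ≤ a_k L_k` and `a_k⁻¹ ≤ (a_k L_k)^N`.  For `S' ≥ L_k` put `y = a_k S' ≥ a_k L_k ≥ 1`;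
then `S' = a_k⁻¹ y ≤ (a_k L_k)^N y ≤ y^{N+1}`, so `2S'+1 ≤ 3 y^{N+1}` and
`(2S'+1)³ e^{−Δ a_k S'/2} ≤ 27 y^{3(N+1)} e^{−Δ y/2} ≤ 27 (2/Δ)^{3(N+1)} (3(N+1))!`
by `yᵖ/p! ≤ eʸ` (`Real.pow_div_factorial_le_exp`).

* `volumeFloor_pow_mul_exp_neg_le` — `xᵖ e^{−Δ x/2} ≤ (2/Δ)ᵖ p!` for `x ≥ 0`, `Δ > 0`;
* `stub_volumeFloor` — the registered statement, with `K = C₀ · 27 · (2/Δ)^{3(N+1)} (3(N+1))!`.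
-/

noncomputable section

open Filter Topology
open Literature.MathematicalPhysics.QuantumFieldTheory
open Summit.QuantumFields.YangMills.Cruxes.HypercubicLimit.CouplingResponse

namespace Summit.QuantumFields.YangMills.Theorems.WeakCouplingHypercubicLimit.TraceNormColdPressure

/-- Polynomial times decaying exponential is bounded: for `Δ > 0`, `x ≥ 0` and every `p`,
`xᵖ e^{−Δ x/2} ≤ (2/Δ)ᵖ p!` (from `yᵖ/p! ≤ eʸ` at `y = Δ x/2`). [folklore] -/
theorem volumeFloor_pow_mul_exp_neg_le {Δ x : ℝ} (hΔ : 0 < Δ) (hx : 0 ≤ x) (p : ℕ) :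
    x ^ p * Real.exp (-(Δ * x / 2)) ≤ (2 / Δ) ^ p * p.factorial := by
  have hy : 0 ≤ Δ * x / 2 := by positivity
  have hp : (0 : ℝ) < p.factorial := by exact_mod_cast p.factorial_pos
  have h : (Δ * x / 2) ^ p ≤ Real.exp (Δ * x / 2) * p.factorial := by
    have := Real.pow_div_factorial_le_exp _ hy p
    rwa [div_le_iff₀ hp] at this
  have hx_eq : x ^ p = (2 / Δ) ^ p * (Δ * x / 2) ^ p := by
    rw [← mul_pow]
    congr 1
    field_simp
  calc x ^ p * Real.exp (-(Δ * x / 2))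
      = (2 / Δ) ^ p * ((Δ * x / 2) ^ p * Real.exp (-(Δ * x / 2))) := by rw [hx_eq]; ring
    _ ≤ (2 / Δ) ^ p * (Real.exp (Δ * x / 2) * p.factorial * Real.exp (-(Δ * x / 2))) :=
        mul_le_mul_of_nonneg_left (mul_le_mul_of_nonneg_right h (Real.exp_pos _).le) (by positivity)
    _ = (2 / Δ) ^ p * p.factorial * (Real.exp (Δ * x / 2) * Real.exp (-(Δ * x / 2))) := by ring
    _ = (2 / Δ) ^ p * p.factorial := by
        rw [← Real.exp_add, add_neg_cancel, Real.exp_zero, mul_one]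

/-- `stub_volumeFloor` (W4, r11; S/M) — **polynomial volume growth gives the volume floor of the cold-pressure
lever.**  Eventually `1 ≤ a_k L_k` (`a_k L_k → ∞`) and `a_k⁻¹ ≤ (a_k L_k)^N` (`PolyVolume`); for `S' ≥ L_k`, with
`y = a_k S' ≥ a_k L_k`, `S' = a_k⁻¹ y ≤ y^{N+1}`, so `2S'+1 ≤ 3 y^{N+1}` and
`(2S'+1)³ e^{−Δ a_k S'/2} ≤ 27 y^{3(N+1)} e^{−Δ y/2} ≤ 27 (2/Δ)^{3(N+1)} (3(N+1))!`. [folklore] -/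
theorem stub_volumeFloor :
    ∀ (ι : Type) (sch : SpeciesScheme ι) (Δ C₀ : ℝ), 0 < Δ → 0 ≤ C₀ → PolyVolume sch →
      ∃ K : ℝ, ∀ᶠ k in Filter.atTop, ∀ S' : ℕ, sch.L k ≤ S' →
        C₀ * ((2 * S' + 1 : ℕ) : ℝ) ^ 3 * Real.exp (-(Δ * sch.a k * S' / 2)) ≤ K := by
  intro ι sch Δ C₀ hΔ hC₀ hpv
  obtain ⟨N, -, hN⟩ := hpv
  refine ⟨C₀ * (27 * ((2 / Δ) ^ (3 * (N + 1)) * (3 * (N + 1)).factorial)), ?_⟩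
  have h1 : ∀ᶠ k in atTop, 1 ≤ sch.a k * sch.L k := sch.tendsto_L.eventually_ge_atTop 1
  filter_upwards [hN, h1] with k hkN hk1 S' hS'
  have ha : 0 < sch.a k := sch.a_pos k
  -- the physical size `y = a_k S'` of the torus of half-side `S'`
  obtain ⟨y, hy⟩ : ∃ y : ℝ, y = sch.a k * S' := ⟨_, rfl⟩
  have hxy : sch.a k * sch.L k ≤ y := by
    rw [hy]
    exact mul_le_mul_of_nonneg_left (by exact_mod_cast hS') ha.le
  have hy1 : 1 ≤ y := hk1.trans hxy
  have hy0 : 0 ≤ y := zero_le_one.trans hy1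
  -- `S' = a_k⁻¹ y ≤ (a_k L_k)^N y ≤ y^(N+1)`
  have hS'eq : (S' : ℝ) = (sch.a k)⁻¹ * y := by rw [hy, inv_mul_cancel_left₀ ha.ne']
  have hS'y : (S' : ℝ) ≤ y ^ (N + 1) := by
    rw [hS'eq, pow_succ]
    calc (sch.a k)⁻¹ * y ≤ (sch.a k * sch.L k) ^ N * y := mul_le_mul_of_nonneg_right hkN hy0
      _ ≤ y ^ N * y :=
          mul_le_mul_of_nonneg_right (pow_le_pow_left₀ (mul_nonneg ha.le (Nat.cast_nonneg _)) hxy N) hy0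
  have h1y : 1 ≤ y ^ (N + 1) := one_le_pow₀ hy1
  have hu : ((2 * S' + 1 : ℕ) : ℝ) ≤ 3 * y ^ (N + 1) := by push_cast; linarith
  have hexp : Real.exp (-(Δ * sch.a k * S' / 2)) = Real.exp (-(Δ * y / 2)) := by
    rw [hy]; congr 1; ring
  calc C₀ * ((2 * S' + 1 : ℕ) : ℝ) ^ 3 * Real.exp (-(Δ * sch.a k * S' / 2))
      = C₀ * (((2 * S' + 1 : ℕ) : ℝ) ^ 3 * Real.exp (-(Δ * y / 2))) := by rw [hexp]; ring
    _ ≤ C₀ * ((3 * y ^ (N + 1)) ^ 3 * Real.exp (-(Δ * y / 2))) :=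
        mul_le_mul_of_nonneg_left
          (mul_le_mul_of_nonneg_right (pow_le_pow_left₀ (by positivity) hu 3) (Real.exp_pos _).le) hC₀
    _ = C₀ * (27 * (y ^ (3 * (N + 1)) * Real.exp (-(Δ * y / 2)))) := by ring
    _ ≤ C₀ * (27 * ((2 / Δ) ^ (3 * (N + 1)) * (3 * (N + 1)).factorial)) :=
        mul_le_mul_of_nonneg_left
          (mul_le_mul_of_nonneg_left (volumeFloor_pow_mul_exp_neg_le hΔ hy0 _) (by norm_num)) hC₀

end Summit.QuantumFields.YangMills.Theorems.WeakCouplingHypercubicLimit.TraceNormColdPressure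

end
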